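import Summits.Ventures.PercRepro.MSTightSingCaseI
import Summits.Ventures.PercRepro.ExcessOneTwoTightTraces

/-!
# (SING-t) at the two tight-trace elements of Theorem (TT)

Dossier proofs/MINE1-theoremS.md, Addenda 30, 32, 35 and 60. With `sing_t` (MSTightSingCaseI.lean)
and Theorem (TT) (`exists_two_tight_proj`: a twin-free family of Marica–Schönheim excess one has two
distinct elements with tight traces), every residue instance `(F, u)` has two distinct elements
`a ≠ b` each of which is a singleton member or a co-singleton member (`exists_two_sing`) — the
bracket of the V chain «residue instance ⟹ (TT) ⟹ [{r} ∈ F or S ∖ r ∈ F] ⟹ (MA) ⟹ (RM*) ⟹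
Lemma R» at the two elements of (TT), in the kernel. `sing_t_of_residue` is `sing_t` with the
residue hypotheses bundled.
-/

namespace PercRepro.MSTight

open Finset
open scoped FinsetFamily

variable {α : Type*} [DecidableEq α] [Fintype α] {F : Finset (Finset α)} {u : Finset α}

/-- **(SING-t), residue form**: in a residue instance every element with a tight trace is a
singleton member or a co-singleton member. -/
theorem sing_t_of_residue (hR : Residue F u) {r : α} (hP : Tight (proj r F)) :
    ({r} : Finset α) ∈ F ∨ univ.erase r ∈ F :=
  sing_t hR.hexc hP hR.htf hR.hcore hR.hsupp hR.hempty hR.huniv hR.hvalid hR.hu hR.hu' hR.hsig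
    hR.hnt hR.hnt'

/-- **(SING-t) at the two elements of Theorem (TT)**: every residue instance has two distinct
elements, each a singleton member or a co-singleton member. -/
theorem exists_two_sing (hR : Residue F u) :
    ∃ a b : α, a ≠ b ∧ (({a} : Finset α) ∈ F ∨ univ.erase a ∈ F) ∧
      (({b} : Finset α) ∈ F ∨ univ.erase b ∈ F) := by
  obtain ⟨a, b, hab, ha, hb⟩ := exists_two_tight_proj hR.htf hR.hexc
  exact ⟨a, b, hab, sing_t_of_residue hR ha, sing_t_of_residue hR hb⟩

end PercRepro.MSTight
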